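import Literature.Barriers.CriticalPhenomena.GridSAWStructuredDrawingCompose
import Literature.Barriers.CriticalPhenomena.GridSAWGadgetsFromDrawnFamily
import HarnessLib

/-!
# Stamping templates: block drawings, their validity, and their data in typed polynomial time

Support for the drawing step `E₀` of `GridSAW.LOT2003_lemma4_gadgets` (Liśkiewicz–Ogihara–Toda
2003, Lemma 4 with the embedding of the proof of Theorem 7), continuing
`GridSAWStructuredDrawingCompose.lean`. The gadget graphs `G(ψ)` formalised in the tree are unions
of many copies of a few fixed pieces (cells, ladders, rail gadgets) on blocks of names
`k, k + 1, …`, joined by local edges. Their grid drawings are produced the same way: a fixed VALID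
drawing of each piece (a *template*, checked once by `SDrawing.validB` and `decide`) is stamped at
many places — names shifted by the block offset, positions translated by a vector — and the
inter-block edges are added afterwards (`SDrawing.addEdges`, `SDrawing.IsValid.addEdges`). This
file provides that layer, down to the typed polynomial-time witness the end of the proof consumes
(`LOT2003_lemma4_gadgets_of_family`, `GridSAWGadgetsFromDrawnFamily.lean`, hypothesis `hSFP`):

* `SDrawing.emptyS`, `SDrawing.concat` (iterated `append`) with `IsValid.concat`,
  `mem_points_concat`, `concat_pos`;
* `SDrawing.copy T k v` — the template `T` with names `a ↦ a + k` and positions translated by `v`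
  (`IsValid.copy`, `copy_verts`, `copy_edges`, `copy_pos_add`, `points_copy`, `degree_copy`);
* `SDrawing.blocks L` for a list `L` of blocks `(T, k, v)`, and **`BlocksOK.isValid`**: if every
  template is valid with names `< B` and points in the box `[0, w) × [0, h)`, the name offsets are
  `≥ B` apart and the translation vectors are `≥ w` apart horizontally or `≥ h` apart vertically,
  then `blocks L` is valid; with the dictionaries `mem_blocks_verts`, `mem_blocks_edges`,
  `mem_points_blocks`, `blocks_pos`, `degree_blocks` needed to add the inter-block edges;
  `templateOKB` is the Boolean form of the per-template conditions (for `decide`);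
* the DATA of a drawing, `S.data = (verts, verts.map pos, edges)` (the first components of the
  `NamedDrawingData` of `GridSAWGadgetsFromDrawnFamily.lean`), the list-level operations `copyD`,
  `appendD`, `concatD`, `addEdgesD` with `data_copy`, `data_append`, `data_concat`,
  **`data_blocks`**, `data_addEdges`;
* typed polynomial time (`CodeFP`) for all of them: `codeFP_shift`, `codeFP_copyD`,
  `codeFP_appendD`, `codeFP_concatD`, **`codeFP_blocksD`**, `codeFP_addEdgesD`, and the packaging
  `codeFP_familyData` into the format `ndC` of `LOT2003_lemma4_gadgets_of_family`;
* `SDrawing.graph` (the graph a drawing draws; `IsValid.graph_adj_iff` is the hypothesis `hadj`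
  of `LOT2003_lemma4_gadgets_of_family`), `hamCount_congr_adj`, and the assembled corollary
  **`LOT2003_lemma4_gadgets_of_drawings`**: the named fact from a family of valid drawings whose
  own graphs have `2^{e ψ} · #SAT(ψ)` Hamiltonian paths, with `CodeFP` data.

## References

* M. Liśkiewicz, M. Ogihara, S. Toda, TCS 304 (2003) 129–156, §4 (proof of Theorem 7: "we apply
  our embedding algorithm to `G′` and obtain a subgraph of a two-dimensional grid … for every two
  edges the paths which realize the edges are vertex disjoint … This is `E₀`").
* S. Arora, B. Barak, *Computational Complexity: A Modern Approach*, CUP 2009, §1.3.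
-/

namespace Literature.Barriers.CriticalPhenomena.GridSAW

open _root_.Computability Literature.Computability.Complexity Literature.Computability.Complexity.CodeFP

namespace SDrawing

section Concat

variable {α : Type*} [DecidableEq α]

/-! ### The empty drawing and concatenation -/

/-- **The empty drawing.** [folklore] -/
def emptyS : SDrawing α := ⟨[], fun _ => (0, 0), []⟩

omit [DecidableEq α] in
/-- The empty drawing has no points. [folklore] -/
@[simp] theorem points_emptyS : (emptyS : SDrawing α).points = [] := rfl

/-- The empty drawing is valid. [folklore] -/
theorem isValid_emptyS : (emptyS : SDrawing α).IsValid :=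
  ⟨List.nodup_nil, by simp [emptyS], by simp [emptyS], by simp [emptyS], by simp [emptyS], by simp [emptyS],
    by simp [emptyS], by simp [emptyS], by simp [emptyS], by simp [emptyS], List.Pairwise.nil, List.Pairwise.nil,
    by simp [emptyS]⟩

/-- **Concatenation** of a list of drawings: iterated juxtaposition. [folklore] -/
def concat : List (SDrawing α) → SDrawing α
  | [] => emptyS
  | S :: l => S.append (concat l)

/-- The concatenation of no drawings. [folklore] -/
@[simp] theorem concat_nil : concat ([] : List (SDrawing α)) = emptyS := rfl

/-- The concatenation of a cons. [folklore] -/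
@[simp] theorem concat_cons (S : SDrawing α) (l : List (SDrawing α)) : concat (S :: l) = S.append (concat l) := rfl

/-- The vertices of a concatenation. [folklore] -/
theorem concat_verts : ∀ l : List (SDrawing α), (concat l).verts = l.flatMap verts
  | [] => rfl
  | S :: l => by rw [concat_cons, List.flatMap_cons, ← concat_verts l]; rfl

/-- The edges of a concatenation. [folklore] -/
theorem concat_edges : ∀ l : List (SDrawing α), (concat l).edges = l.flatMap edges
  | [] => rfl
  | S :: l => by rw [concat_cons, List.flatMap_cons, ← concat_edges l]; rfl

/-- Membership in the vertices of a concatenation. [folklore] -/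
theorem mem_concat_verts {l : List (SDrawing α)} {a : α} : a ∈ (concat l).verts ↔ ∃ S ∈ l, a ∈ S.verts := by
  rw [concat_verts, List.mem_flatMap]

/-- Membership in the edges of a concatenation. [folklore] -/
theorem mem_concat_edges {l : List (SDrawing α)} {e : SEdge α} : e ∈ (concat l).edges ↔ ∃ S ∈ l, e ∈ S.edges := by
  rw [concat_edges, List.mem_flatMap]

/-- Positions in a concatenation of drawings on pairwise disjoint names. [folklore] -/
theorem concat_pos : ∀ {l : List (SDrawing α)}, l.Pairwise (fun S T => ∀ a ∈ S.verts, a ∉ T.verts) →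
    ∀ {S : SDrawing α}, S ∈ l → ∀ {a : α}, a ∈ S.verts → (concat l).pos a = S.pos a
  | [], _, S, hS, _, _ => by simp at hS
  | T :: l, hl, S, hS, a, ha => by
    rw [concat_cons]
    rw [List.pairwise_cons] at hl
    rcases List.mem_cons.1 hS with rfl | hS
    · exact append_pos_left ha
    · have hne : a ∉ T.verts := fun h => hl.1 S hS a h ha
      rw [append_pos_right hne]
      exact concat_pos hl.2 hS ha

/-- The points of a juxtaposition of drawings on disjoint names. [folklore] -/
theorem mem_points_append {S₁ S₂ : SDrawing α} (hV : ∀ a ∈ S₁.verts, a ∉ S₂.verts) {p : GridPoint} :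
    p ∈ (S₁.append S₂).points ↔ p ∈ S₁.points ∨ p ∈ S₂.points := by
  have hV' : ∀ a ∈ S₂.verts, a ∉ S₁.verts := fun a ha ha' => hV a ha' ha
  simp only [mem_points_iff]
  constructor
  · rintro (⟨v, hv, rfl⟩ | ⟨e, he, hp⟩)
    · rcases List.mem_append.1 hv with hv | hv
      · exact Or.inl (Or.inl ⟨v, hv, (append_pos_left hv).symm⟩)
      · exact Or.inr (Or.inl ⟨v, hv, (append_pos_right (hV' v hv)).symm⟩)
    · rcases List.mem_append.1 he with he | he
      · exact Or.inl (Or.inr ⟨e, he, hp⟩)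
      · exact Or.inr (Or.inr ⟨e, he, hp⟩)
  · rintro ((⟨v, hv, rfl⟩ | ⟨e, he, hp⟩) | (⟨v, hv, rfl⟩ | ⟨e, he, hp⟩))
    · exact Or.inl ⟨v, List.mem_append_left _ hv, append_pos_left hv⟩
    · exact Or.inr ⟨e, List.mem_append_left _ he, hp⟩
    · exact Or.inl ⟨v, List.mem_append_right _ hv, append_pos_right (hV' v hv)⟩
    · exact Or.inr ⟨e, List.mem_append_right _ he, hp⟩

/-- The points of a concatenation of drawings on pairwise disjoint names. [folklore] -/
theorem mem_points_concat {l : List (SDrawing α)} (hl : l.Pairwise fun S T => ∀ a ∈ S.verts, a ∉ T.verts)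
    {p : GridPoint} : p ∈ (concat l).points ↔ ∃ S ∈ l, p ∈ S.points := by
  induction l with
  | nil => simp
  | cons T l ih =>
    rw [List.pairwise_cons] at hl
    have hV : ∀ a ∈ T.verts, a ∉ (concat l).verts := fun a ha h => by
      obtain ⟨S, hS, haS⟩ := mem_concat_verts.1 h
      exact hl.1 S hS a ha haS
    rw [concat_cons, mem_points_append hV, ih hl.2]
    simp

/-- **Validity of a concatenation**: valid drawings on pairwise disjoint names with pairwise
disjoint point sets concatenate to a valid drawing. [cite: LiskiewiczOgiharaToda2003, §4 (proof of Theorem 7, "vertex disjoint")] -/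
theorem IsValid.concat {l : List (SDrawing α)} (hval : ∀ S ∈ l, S.IsValid)
    (hV : l.Pairwise fun S T => ∀ a ∈ S.verts, a ∉ T.verts)
    (hP : l.Pairwise fun S T => ∀ p ∈ S.points, p ∉ T.points) : (concat l).IsValid := by
  induction l with
  | nil => exact isValid_emptyS
  | cons T l ih =>
    rw [List.pairwise_cons] at hV hP
    refine (hval T (by simp)).append (ih (fun S hS => hval S (by simp [hS])) hV.2 hP.2) ?_ ?_
    · intro a ha h
      obtain ⟨S, hS, haS⟩ := mem_concat_verts.1 h
      exact hV.1 S hS a ha haS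
    · intro p hp h
      obtain ⟨S, hS, hpS⟩ := (mem_points_concat hV.2).1 h
      exact hP.1 S hS p hp hpS

/-- The degree in a concatenation. [folklore] -/
theorem degree_concat (a : α) : ∀ l : List (SDrawing α), (concat l).degree a = (l.map fun S => S.degree a).sum
  | [] => by simp [emptyS, degree]
  | S :: l => by rw [concat_cons, degree_append, degree_concat a l, List.map_cons, List.sum_cons]

end Concat

/-! ### Copies of a template -/

section Copy

variable (T : SDrawing ℕ) (k : ℕ) (v : GridPoint)

/-- **A copy of the template `T`**: names shifted by `k`, positions translated by `v`. [cite: LiskiewiczOgiharaToda2003, §4 (proof of Theorem 7, E₀)] -/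
def copy : SDrawing ℕ := (T.relabel (· + k) (· - k)).translate v

/-- The vertices of a copy. [folklore] -/
@[simp] theorem copy_verts : (T.copy k v).verts = T.verts.map (· + k) := rfl

/-- The positions of a copy. [folklore] -/
theorem copy_pos (b : ℕ) : (T.copy k v).pos b = shift v (T.pos (b - k)) := rfl

/-- The position of a shifted name. [folklore] -/
@[simp] theorem copy_pos_add (a : ℕ) : (T.copy k v).pos (a + k) = shift v (T.pos a) := by
  rw [copy_pos, Nat.add_sub_cancel]

/-- The edges of a copy. [folklore] -/
theorem copy_edges : (T.copy k v).edges = T.edges.map fun e => (e.1 + k, e.2.1 + k, e.2.2.map (shift v)) := by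
  simp [copy, relabel, translate, List.map_map, Function.comp_def]

/-- Membership in the vertices of a copy. [folklore] -/
theorem mem_copy_verts {b : ℕ} : b ∈ (T.copy k v).verts ↔ ∃ a ∈ T.verts, a + k = b := by
  rw [copy_verts, List.mem_map]

/-- Membership in the edges of a copy. [folklore] -/
theorem mem_copy_edges {e : SEdge ℕ} :
    e ∈ (T.copy k v).edges ↔ ∃ e₀ ∈ T.edges, (e₀.1 + k, e₀.2.1 + k, e₀.2.2.map (shift v)) = e := by
  rw [copy_edges, List.mem_map]

/-- **A copy of a valid template is valid.** [cite: LiskiewiczOgiharaToda2003, §4 (proof of Theorem 7)] -/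
theorem IsValid.copy {T : SDrawing ℕ} (hT : T.IsValid) (k : ℕ) (v : GridPoint) : (T.copy k v).IsValid :=
  (hT.relabel (· + k) (· - k) fun a _ => Nat.add_sub_cancel a k).translate v

/-- The points of a copy are the translated points of the template. [folklore] -/
theorem points_copy : (T.copy k v).points = T.points.map (shift v) := by
  simp only [points, copy, relabel, translate, List.map_map, Function.comp_def, Nat.add_sub_cancel, List.map_append,
    List.map_flatMap, List.flatMap_map]

/-- Membership in the points of a copy. [folklore] -/
theorem mem_points_copy {p : GridPoint} : p ∈ (T.copy k v).points ↔ ∃ q ∈ T.points, shift v q = p := by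
  rw [points_copy, List.mem_map]

/-- The degree of a shifted name in a copy of a valid template. [folklore] -/
theorem degree_copy {T : SDrawing ℕ} (hT : T.IsValid) (k : ℕ) (v : GridPoint) {a : ℕ} (ha : a ∈ T.verts) :
    (T.copy k v).degree (a + k) = T.degree a := by
  rw [copy, degree_translate, degree_relabel hT (fun a _ => Nat.add_sub_cancel a k) ha]

/-- A name that is not a shifted template name has degree zero in the copy of a valid template.
[folklore] -/
theorem degree_copy_eq_zero {T : SDrawing ℕ} (hT : T.IsValid) (k : ℕ) (v : GridPoint) {b : ℕ}
    (hb : ∀ a ∈ T.verts, a + k ≠ b) : (T.copy k v).degree b = 0 := by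
  refine degree_eq_zero fun e he => ?_
  obtain ⟨e₀, he₀, rfl⟩ := (mem_copy_edges T k v).1 he
  exact ⟨hb _ (hT.fst_mem e₀ he₀), hb _ (hT.snd_mem e₀ he₀)⟩

end Copy

/-! ### Blocks -/

section Blocks

/-- A block: a template, a name offset, a translation vector. [folklore] -/
abbrev Block : Type := SDrawing ℕ × ℕ × GridPoint

/-- The copy a block stands for. [folklore] -/
def Block.toCopy (b : Block) : SDrawing ℕ := b.1.copy b.2.1 b.2.2

/-- **The drawing of a list of blocks**: the concatenation of the copies. [cite: LiskiewiczOgiharaToda2003, §4 (proof of Theorem 7, E₀)] -/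
def blocks (L : List Block) : SDrawing ℕ := concat (L.map Block.toCopy)

/-- No blocks. [folklore] -/
@[simp] theorem blocks_nil : blocks [] = emptyS := rfl

/-- A cons of blocks. [folklore] -/
@[simp] theorem blocks_cons (b : Block) (L : List Block) : blocks (b :: L) = (b.1.copy b.2.1 b.2.2).append (blocks L) := rfl

/-- Membership in the vertices of a block drawing. [folklore] -/
theorem mem_blocks_verts {L : List Block} {x : ℕ} : x ∈ (blocks L).verts ↔ ∃ b ∈ L, ∃ a ∈ b.1.verts, a + b.2.1 = x := by
  rw [blocks, mem_concat_verts]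
  constructor
  · rintro ⟨S, hS, hx⟩
    obtain ⟨b, hb, rfl⟩ := List.mem_map.1 hS
    exact ⟨b, hb, (mem_copy_verts _ _ _).1 hx⟩
  · rintro ⟨b, hb, hx⟩
    exact ⟨b.toCopy, List.mem_map_of_mem hb, (mem_copy_verts _ _ _).2 hx⟩

/-- Membership in the edges of a block drawing. [folklore] -/
theorem mem_blocks_edges {L : List Block} {e : SEdge ℕ} :
    e ∈ (blocks L).edges ↔ ∃ b ∈ L, ∃ e₀ ∈ b.1.edges, (e₀.1 + b.2.1, e₀.2.1 + b.2.1, e₀.2.2.map (shift b.2.2)) = e := by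
  rw [blocks, mem_concat_edges]
  constructor
  · rintro ⟨S, hS, he⟩
    obtain ⟨b, hb, rfl⟩ := List.mem_map.1 hS
    exact ⟨b, hb, (mem_copy_edges _ _ _).1 he⟩
  · rintro ⟨b, hb, he⟩
    exact ⟨b.toCopy, List.mem_map_of_mem hb, (mem_copy_edges _ _ _).2 he⟩

/-- The vertex list of a block drawing. [folklore] -/
theorem blocks_verts (L : List Block) : (blocks L).verts = L.flatMap fun b => b.1.verts.map (· + b.2.1) := by
  rw [blocks, concat_verts, List.flatMap_map]; rfl

/-- The edge list of a block drawing. [folklore] -/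
theorem blocks_edges (L : List Block) :
    (blocks L).edges = L.flatMap fun b => b.1.edges.map fun e => (e.1 + b.2.1, e.2.1 + b.2.1, e.2.2.map (shift b.2.2)) := by
  rw [blocks, concat_edges, List.flatMap_map]
  congr 1
  funext b
  exact copy_edges _ _ _

/-- **Admissible block lists** (for a name bound `B` and a box `w × h`): valid templates with
names below `B` and points in `[0, w) × [0, h)`; name offsets pairwise `≥ B` apart; translation
vectors pairwise `≥ w` apart horizontally or `≥ h` apart vertically. [cite: LiskiewiczOgiharaToda2003, §4 (proof of Theorem 7, "vertex disjoint")] -/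
structure BlocksOK (B w h : ℕ) (L : List Block) : Prop where
  /-- templates are valid -/
  valid : ∀ b ∈ L, b.1.IsValid
  /-- template names are below `B` -/
  names_lt : ∀ b ∈ L, ∀ a ∈ b.1.verts, a < B
  /-- template points are in the box -/
  inBox : ∀ b ∈ L, ∀ p ∈ b.1.points, 0 ≤ p.1 ∧ p.1 < (w : ℤ) ∧ 0 ≤ p.2 ∧ p.2 < (h : ℤ)
  /-- name offsets are apart -/
  names_apart : L.Pairwise fun b c => b.2.1 + B ≤ c.2.1 ∨ c.2.1 + B ≤ b.2.1
  /-- boxes are apart -/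
  boxes_apart : L.Pairwise fun b c : Block =>
    b.2.2.1 + (w : ℤ) ≤ c.2.2.1 ∨ c.2.2.1 + (w : ℤ) ≤ b.2.2.1 ∨ b.2.2.2 + (h : ℤ) ≤ c.2.2.2 ∨ c.2.2.2 + (h : ℤ) ≤ b.2.2.2

namespace BlocksOK

variable {B w h : ℕ} {L : List Block}

/-- The tail of an admissible block list is admissible. [folklore] -/
theorem tail {b : Block} (hL : BlocksOK B w h (b :: L)) : BlocksOK B w h L :=
  ⟨fun c hc => hL.valid c (List.mem_cons_of_mem _ hc), fun c hc => hL.names_lt c (List.mem_cons_of_mem _ hc),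
    fun c hc => hL.inBox c (List.mem_cons_of_mem _ hc), (List.pairwise_cons.1 hL.names_apart).2,
    (List.pairwise_cons.1 hL.boxes_apart).2⟩

/-- Two apart blocks have disjoint names. [folklore] -/
theorem names_disjoint_of_apart {b c : Block} (hb : ∀ a ∈ b.1.verts, a < B) (hc : ∀ a ∈ c.1.verts, a < B)
    (hapart : b.2.1 + B ≤ c.2.1 ∨ c.2.1 + B ≤ b.2.1) : ∀ x ∈ b.toCopy.verts, x ∉ c.toCopy.verts := by
  intro x hx hx'
  obtain ⟨a, ha, rfl⟩ := (mem_copy_verts _ _ _).1 hx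
  obtain ⟨a', ha', h⟩ := (mem_copy_verts _ _ _).1 hx'
  have h1 := hb a ha
  have h2 := hc a' ha'
  omega

/-- Two apart blocks have disjoint point sets. [folklore] -/
theorem points_disjoint_of_apart {b c : Block} (hb : ∀ p ∈ b.1.points, 0 ≤ p.1 ∧ p.1 < (w : ℤ) ∧ 0 ≤ p.2 ∧ p.2 < (h : ℤ))
    (hc : ∀ p ∈ c.1.points, 0 ≤ p.1 ∧ p.1 < (w : ℤ) ∧ 0 ≤ p.2 ∧ p.2 < (h : ℤ))
    (hapart : b.2.2.1 + (w : ℤ) ≤ c.2.2.1 ∨ c.2.2.1 + (w : ℤ) ≤ b.2.2.1 ∨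
      b.2.2.2 + (h : ℤ) ≤ c.2.2.2 ∨ c.2.2.2 + (h : ℤ) ≤ b.2.2.2) :
    ∀ p ∈ b.toCopy.points, p ∉ c.toCopy.points := by
  intro p hp hp'
  obtain ⟨q, hq, rfl⟩ := (mem_points_copy _ _ _).1 hp
  obtain ⟨q', hq', hqq⟩ := (mem_points_copy _ _ _).1 hp'
  have h1 := hb q hq
  have h2 := hc q' hq'
  simp only [shift, Prod.mk.injEq] at hqq
  omega

/-- The copies of an admissible block list have pairwise disjoint names. [folklore] -/
theorem names_disjoint (hL : BlocksOK B w h L) :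
    (L.map Block.toCopy).Pairwise fun S T => ∀ a ∈ S.verts, a ∉ T.verts := by
  rw [List.pairwise_map]
  exact hL.names_apart.imp_of_mem fun {b c} hb hc h =>
    names_disjoint_of_apart (hL.names_lt b hb) (hL.names_lt c hc) h

/-- The copies of an admissible block list have pairwise disjoint point sets. [folklore] -/
theorem points_disjoint (hL : BlocksOK B w h L) :
    (L.map Block.toCopy).Pairwise fun S T => ∀ p ∈ S.points, p ∉ T.points := by
  rw [List.pairwise_map]
  exact hL.boxes_apart.imp_of_mem fun {b c} hb hc h =>
    points_disjoint_of_apart (hL.inBox b hb) (hL.inBox c hc) h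

/-- **The drawing of an admissible block list is valid.** [cite: LiskiewiczOgiharaToda2003, §4 (proof of Theorem 7, E₀)] -/
theorem isValid (hL : BlocksOK B w h L) : (blocks L).IsValid :=
  IsValid.concat (fun S hS => by
    obtain ⟨b, hb, rfl⟩ := List.mem_map.1 hS
    exact (hL.valid b hb).copy _ _) hL.names_disjoint hL.points_disjoint

/-- Positions in the drawing of an admissible block list. [folklore] -/
theorem blocks_pos (hL : BlocksOK B w h L) {b : Block} (hb : b ∈ L) {a : ℕ} (ha : a ∈ b.1.verts) :
    (blocks L).pos (a + b.2.1) = shift b.2.2 (b.1.pos a) := by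
  rw [blocks, concat_pos hL.names_disjoint (List.mem_map_of_mem hb) ((mem_copy_verts _ _ _).2 ⟨a, ha, rfl⟩)]
  exact copy_pos_add _ _ _ _

/-- The points of the drawing of an admissible block list. [folklore] -/
theorem mem_points_blocks (hL : BlocksOK B w h L) {p : GridPoint} :
    p ∈ (blocks L).points ↔ ∃ b ∈ L, ∃ q ∈ b.1.points, shift b.2.2 q = p := by
  rw [blocks, mem_points_concat hL.names_disjoint]
  constructor
  · rintro ⟨S, hS, hp⟩
    obtain ⟨b, hb, rfl⟩ := List.mem_map.1 hS
    exact ⟨b, hb, (mem_points_copy _ _ _).1 hp⟩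
  · rintro ⟨b, hb, hp⟩
    exact ⟨b.toCopy, List.mem_map_of_mem hb, (mem_points_copy _ _ _).2 hp⟩

/-- A shifted name of one block is not a shifted name of another block. [folklore] -/
theorem ne_of_mem {b c : Block} (hb : ∀ a ∈ b.1.verts, a < B) (hc : ∀ a ∈ c.1.verts, a < B)
    (hapart : b.2.1 + B ≤ c.2.1 ∨ c.2.1 + B ≤ b.2.1) {a a' : ℕ} (ha : a ∈ b.1.verts) (ha' : a' ∈ c.1.verts) :
    a' + c.2.1 ≠ a + b.2.1 := by
  have h1 := hb a ha
  have h2 := hc a' ha'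
  omega

/-- **Degrees in the drawing of an admissible block list** are the template degrees. [folklore] -/
theorem degree_blocks (hL : BlocksOK B w h L) {b : Block} (hb : b ∈ L) {a : ℕ} (ha : a ∈ b.1.verts) :
    (blocks L).degree (a + b.2.1) = b.1.degree a := by
  induction L with
  | nil => simp at hb
  | cons c L ih =>
    rw [blocks_cons, degree_append]
    have hapart := (List.pairwise_cons.1 hL.names_apart).1
    rcases List.mem_cons.1 hb with rfl | hb
    · have h0 : (blocks L).degree (a + b.2.1) = 0 := by
        refine degree_eq_zero fun e he => ?_
        obtain ⟨c, hc, e₀, he₀, rfl⟩ := mem_blocks_edges.1 he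
        have hv := hL.tail.valid c hc
        exact ⟨ne_of_mem (hL.names_lt b (by simp)) (hL.names_lt c (List.mem_cons_of_mem _ hc)) (hapart c hc) ha
            (hv.fst_mem e₀ he₀),
          ne_of_mem (hL.names_lt b (by simp)) (hL.names_lt c (List.mem_cons_of_mem _ hc)) (hapart c hc) ha
            (hv.snd_mem e₀ he₀)⟩
      rw [degree_copy (hL.valid b (by simp)) _ _ ha, h0, Nat.add_zero]
    · rw [ih hL.tail hb, degree_copy_eq_zero (hL.valid c (by simp)) _ _ (fun a' ha' =>
        ne_of_mem (hL.names_lt b (List.mem_cons_of_mem _ hb)) (hL.names_lt c (by simp)) (hapart b hb).symm ha ha'),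
        Nat.zero_add]

end BlocksOK

/-- **Boolean template check**: valid, names below `B`, points in the box `[0, w) × [0, h)` (for
`decide` on explicit templates). [folklore] -/
def templateOKB (B w h : ℕ) (T : SDrawing ℕ) : Bool :=
  T.validB && (T.verts.all fun a => decide (a < B)) &&
    (T.points.all fun p => decide (0 ≤ p.1 ∧ p.1 < (w : ℤ) ∧ 0 ≤ p.2 ∧ p.2 < (h : ℤ)))

/-- What the template check certifies. [folklore] -/
theorem templateOKB_spec {B w h : ℕ} {T : SDrawing ℕ} (hT : templateOKB B w h T = true) :
    T.IsValid ∧ (∀ a ∈ T.verts, a < B) ∧ ∀ p ∈ T.points, 0 ≤ p.1 ∧ p.1 < (w : ℤ) ∧ 0 ≤ p.2 ∧ p.2 < (h : ℤ) := by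
  simp only [templateOKB, Bool.and_eq_true, List.all_eq_true, decide_eq_true_eq] at hT
  exact ⟨isValid_of_validB hT.1.1, hT.1.2, hT.2⟩

/-- **Admissibility from the template check**: if every template of `L` passes `templateOKB B w h`
and the offsets are apart, `L` is admissible. [folklore] -/
theorem blocksOK_of_templateOKB {B w h : ℕ} {L : List Block} (hT : ∀ b ∈ L, templateOKB B w h b.1 = true)
    (hnames : L.Pairwise fun b c => b.2.1 + B ≤ c.2.1 ∨ c.2.1 + B ≤ b.2.1)
    (hboxes : L.Pairwise fun b c : Block =>
      b.2.2.1 + (w : ℤ) ≤ c.2.2.1 ∨ c.2.2.1 + (w : ℤ) ≤ b.2.2.1 ∨ b.2.2.2 + (h : ℤ) ≤ c.2.2.2 ∨ c.2.2.2 + (h : ℤ) ≤ b.2.2.2) :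
    BlocksOK B w h L :=
  ⟨fun b hb => (templateOKB_spec (hT b hb)).1, fun b hb => (templateOKB_spec (hT b hb)).2.1,
    fun b hb => (templateOKB_spec (hT b hb)).2.2, hnames, hboxes⟩

/-- A one-edge stamp on the names `0, 1` (sanity check of the template check). [folklore] -/
def unitStamp : SDrawing ℕ := ⟨[0, 1], fun a => if a = 0 then (0, 0) else (1, 0), [(0, 1, [(0, 0), (1, 0)])]⟩

/-- Sanity check: the unit stamp passes the template check with `B = 2`, box `2 × 1` (by `decide`).
[folklore] -/
theorem templateOKB_unitStamp : templateOKB 2 2 1 unitStamp = true := by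
  decide

end Blocks

/-! ### The data of a drawing and the list-level operations -/

section Data

/-- The data of a named drawing handed to the machine: names, aligned positions, edges (the first
three components of `NamedDrawingData`). [cite: LiskiewiczOgiharaToda2003, §4 (E₀)] -/
abbrev SDData : Type := List ℕ × List GridPoint × List (SEdge ℕ)

/-- **The data of a drawing.** [folklore] -/
def data (S : SDrawing ℕ) : SDData := (S.verts, S.verts.map S.pos, S.edges)

/-- The names component. [folklore] -/
@[simp] theorem data_fst (S : SDrawing ℕ) : S.data.1 = S.verts := rfl

/-- The positions component. [folklore] -/
@[simp] theorem data_snd_fst (S : SDrawing ℕ) : S.data.2.1 = S.verts.map S.pos := rfl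

/-- The edges component. [folklore] -/
@[simp] theorem data_snd_snd (S : SDrawing ℕ) : S.data.2.2 = S.edges := rfl

/-- The data of the empty drawing. [folklore] -/
@[simp] theorem data_emptyS : (emptyS : SDrawing ℕ).data = ([], [], []) := rfl

/-- Copying, on data. [folklore] -/
def copyD (d : SDData) (k : ℕ) (v : GridPoint) : SDData :=
  (d.1.map (· + k), d.2.1.map (shift v), d.2.2.map fun e => (e.1 + k, e.2.1 + k, e.2.2.map (shift v)))

/-- **The data of a copy.** [folklore] -/
theorem data_copy (T : SDrawing ℕ) (k : ℕ) (v : GridPoint) : (T.copy k v).data = copyD T.data k v := by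
  refine Prod.ext rfl (Prod.ext ?_ (copy_edges T k v))
  show (T.verts.map (· + k)).map (T.copy k v).pos = (T.verts.map T.pos).map (shift v)
  rw [List.map_map, List.map_map]
  exact List.map_congr_left fun a _ => copy_pos_add T k v a

/-- Juxtaposition, on data. [folklore] -/
def appendD (d₁ d₂ : SDData) : SDData := (d₁.1 ++ d₂.1, d₁.2.1 ++ d₂.2.1, d₁.2.2 ++ d₂.2.2)

/-- **The data of a juxtaposition** of drawings on disjoint names. [folklore] -/
theorem data_append {S₁ S₂ : SDrawing ℕ} (hV : ∀ a ∈ S₁.verts, a ∉ S₂.verts) :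
    (S₁.append S₂).data = appendD S₁.data S₂.data := by
  have hV' : ∀ a ∈ S₂.verts, a ∉ S₁.verts := fun a ha ha' => hV a ha' ha
  refine Prod.ext rfl (Prod.ext ?_ rfl)
  show (S₁.verts ++ S₂.verts).map (S₁.append S₂).pos = S₁.verts.map S₁.pos ++ S₂.verts.map S₂.pos
  rw [List.map_append]
  congr 1
  · exact List.map_congr_left fun a ha => append_pos_left ha
  · exact List.map_congr_left fun a ha => append_pos_right (hV' a ha)

/-- Concatenation, on data. [folklore] -/
def concatD : List SDData → SDData
  | [] => ([], [], [])
  | d :: l => appendD d (concatD l)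

/-- `concatD` componentwise. [folklore] -/
theorem concatD_eq (l : List SDData) :
    concatD l = ((l.map fun d => d.1).flatten, (l.map fun d => d.2.1).flatten, (l.map fun d => d.2.2).flatten) := by
  induction l with
  | nil => rfl
  | cons d l ih => rw [concatD, ih]; rfl

/-- **The data of a concatenation** of drawings on pairwise disjoint names. [folklore] -/
theorem data_concat {l : List (SDrawing ℕ)} (hl : l.Pairwise fun S T => ∀ a ∈ S.verts, a ∉ T.verts) :
    (concat l).data = concatD (l.map data) := by
  induction l with
  | nil => rfl
  | cons T l ih =>
    rw [List.pairwise_cons] at hl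
    have hV : ∀ a ∈ T.verts, a ∉ (concat l).verts := fun a ha h => by
      obtain ⟨S, hS, haS⟩ := mem_concat_verts.1 h
      exact hl.1 S hS a ha haS
    rw [concat_cons, data_append hV, ih hl.2, List.map_cons, concatD]

/-- **The data of a block drawing.** [folklore] -/
theorem data_blocks {B w h : ℕ} {L : List Block} (hL : BlocksOK B w h L) :
    (blocks L).data = concatD (L.map fun b => copyD b.1.data b.2.1 b.2.2) := by
  rw [blocks, data_concat hL.names_disjoint, List.map_map]
  congr 1
  exact List.map_congr_left fun b _ => data_copy _ _ _

/-- Adding edges, on data. [folklore] -/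
def addEdgesD (d : SDData) (E : List (SEdge ℕ)) : SDData := (d.1, d.2.1, d.2.2 ++ E)

/-- The data after adding edges. [folklore] -/
theorem data_addEdges (S : SDrawing ℕ) (E : List (SEdge ℕ)) : (S.addEdges E).data = addEdgesD S.data E := rfl

/-- The data of a translate. [folklore] -/
theorem data_translate (S : SDrawing ℕ) (v : GridPoint) :
    (S.translate v).data = (S.verts, (S.verts.map S.pos).map (shift v), S.edges.map fun e => (e.1, e.2.1, e.2.2.map (shift v))) := by
  refine Prod.ext rfl (Prod.ext ?_ rfl)
  show S.verts.map (fun a => shift v (S.pos a)) = (S.verts.map S.pos).map (shift v)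
  rw [List.map_map]; rfl

end Data

/-! ### Typed polynomial time -/

section FP

/-- The code of drawing data (raw lists, the format of `ndC`). [cite: AroraBarak2009, §0.1] -/
abbrev sddC : SDData → List Bool := pairE (rawE natE) (pairE (rawE gpC) (rawE sedgeC))

/-- Addition of sign–magnitude integers. [cite: AroraBarak2009, §1.3] -/
theorem codeFP_smAdd : CodeFP (pairE smE smE) smE (fun p => p.1 + p.2) :=
  (smOfInt.comp (intAdd.comp ((intOfSM.comp (fst smE smE)).pair (intOfSM.comp (snd smE smE))))).congr fun _ => rfl

/-- **Translation of a grid point** `(v, p) ↦ shift v p`. [cite: AroraBarak2009, §1.3] -/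
theorem codeFP_shift : CodeFP (pairE gpC gpC) gpC (fun q => shift q.1 q.2) := by
  have hv1 : CodeFP (pairE gpC gpC) smE (fun q => q.1.1) := (fst _ _).fst'
  have hv2 : CodeFP (pairE gpC gpC) smE (fun q => q.1.2) := (fst _ _).snd'
  have hp1 : CodeFP (pairE gpC gpC) smE (fun q => q.2.1) := (snd _ _).fst'
  have hp2 : CodeFP (pairE gpC gpC) smE (fun q => q.2.2) := (snd _ _).snd'
  exact ((codeFP_smAdd.comp (hp1.pair hv1)).pair (codeFP_smAdd.comp (hp2.pair hv2))).congr fun _ => rfl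

/-- Translation of a path (context: the vector). [cite: AroraBarak2009, §1.3] -/
theorem codeFP_shiftPath : CodeFP (pairE gpC (rawE gpC)) (rawE gpC) (fun q => q.2.map (shift q.1)) :=
  (map (σ := GridPoint) (eσ := gpC) codeFP_shift).congr fun _ => rfl

/-- Copying one named edge (context: offset and vector). [cite: AroraBarak2009, §1.3] -/
theorem codeFP_copyEdge : CodeFP (pairE (pairE natE gpC) sedgeC) sedgeC
    (fun q => (q.2.1 + q.1.1, q.2.2.1 + q.1.1, q.2.2.2.map (shift q.1.2))) := by
  have hk : CodeFP (pairE (pairE natE gpC) sedgeC) natE (fun q => q.1.1) := (fst _ _).fst'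
  have hv : CodeFP (pairE (pairE natE gpC) sedgeC) gpC (fun q => q.1.2) := (fst _ _).snd'
  have ha : CodeFP (pairE (pairE natE gpC) sedgeC) natE (fun q => q.2.1) := (snd _ _).fst'
  have hb : CodeFP (pairE (pairE natE gpC) sedgeC) natE (fun q => q.2.2.1) := (snd _ _).snd'.fst'
  have hπ : CodeFP (pairE (pairE natE gpC) sedgeC) (rawE gpC) (fun q => q.2.2.2) := (snd _ _).snd'.snd'
  exact ((natAdd.comp (ha.pair hk)).pair ((natAdd.comp (hb.pair hk)).pair (codeFP_shiftPath.comp (hv.pair hπ)))).congr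
    fun _ => rfl

/-- **Copying drawing data** `(d, k, v) ↦ copyD d k v`. [cite: AroraBarak2009, §1.3] -/
theorem codeFP_copyD : CodeFP (pairE sddC (pairE natE gpC)) sddC (fun q => copyD q.1 q.2.1 q.2.2) := by
  have hd1 : CodeFP (pairE sddC (pairE natE gpC)) (rawE natE) (fun q => q.1.1) := (fst _ _).fst'
  have hd2 : CodeFP (pairE sddC (pairE natE gpC)) (rawE gpC) (fun q => q.1.2.1) := (fst _ _).snd'.fst'
  have hd3 : CodeFP (pairE sddC (pairE natE gpC)) (rawE sedgeC) (fun q => q.1.2.2) := (fst _ _).snd'.snd'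
  have hv : CodeFP (pairE sddC (pairE natE gpC)) gpC (fun q => q.2.2) := (snd _ _).snd'
  have hkv : CodeFP (pairE sddC (pairE natE gpC)) (pairE natE gpC) (fun q => q.2) := snd _ _
  -- names: item `a`, context `(k, v)`, value `a + k`
  have hadd : CodeFP (pairE (pairE natE gpC) natE) natE (fun r => r.2 + r.1.1) :=
    (natAdd.comp ((snd (pairE natE gpC) natE).pair (fst (pairE natE gpC) natE).fst')).congr fun _ => rfl
  have h1 : CodeFP (pairE sddC (pairE natE gpC)) (rawE natE) (fun q => q.1.1.map fun a => a + q.2.1) :=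
    ((map (σ := ℕ × GridPoint) (eσ := pairE natE gpC) hadd).comp (hkv.pair hd1)).congr fun _ => rfl
  -- positions
  have h2 : CodeFP (pairE sddC (pairE natE gpC)) (rawE gpC) (fun q => q.1.2.1.map (shift q.2.2)) :=
    (codeFP_shiftPath.comp (hv.pair hd2)).congr fun _ => rfl
  -- edges
  have h3 : CodeFP (pairE sddC (pairE natE gpC)) (rawE sedgeC)
      (fun q => q.1.2.2.map fun e => (e.1 + q.2.1, e.2.1 + q.2.1, e.2.2.map (shift q.2.2))) :=
    ((map (σ := ℕ × GridPoint) (eσ := pairE natE gpC) codeFP_copyEdge).comp (hkv.pair hd3)).congr fun _ => rfl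
  exact (h1.pair (h2.pair h3)).congr fun _ => rfl

/-- **Juxtaposition of drawing data.** [cite: AroraBarak2009, §1.3] -/
theorem codeFP_appendD : CodeFP (pairE sddC sddC) sddC (fun q => appendD q.1 q.2) := by
  have ha1 : CodeFP (pairE sddC sddC) (rawE natE) (fun q => q.1.1) := (fst _ _).fst'
  have ha2 : CodeFP (pairE sddC sddC) (rawE gpC) (fun q => q.1.2.1) := (fst _ _).snd'.fst'
  have ha3 : CodeFP (pairE sddC sddC) (rawE sedgeC) (fun q => q.1.2.2) := (fst _ _).snd'.snd'
  have hb1 : CodeFP (pairE sddC sddC) (rawE natE) (fun q => q.2.1) := (snd _ _).fst'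
  have hb2 : CodeFP (pairE sddC sddC) (rawE gpC) (fun q => q.2.2.1) := (snd _ _).snd'.fst'
  have hb3 : CodeFP (pairE sddC sddC) (rawE sedgeC) (fun q => q.2.2.2) := (snd _ _).snd'.snd'
  exact (((rawAppend natE).comp (ha1.pair hb1)).pair (((rawAppend gpC).comp (ha2.pair hb2)).pair
    ((rawAppend sedgeC).comp (ha3.pair hb3)))).congr fun _ => rfl

/-- **Concatenation of drawing data.** [cite: AroraBarak2009, §1.3] -/
theorem codeFP_concatD : CodeFP (rawE sddC) sddC concatD := by
  have h1 : CodeFP sddC (rawE natE) (fun d => d.1) := fst _ _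
  have h2 : CodeFP sddC (rawE gpC) (fun d => d.2.1) := (snd _ _).fst'
  have h3 : CodeFP sddC (rawE sedgeC) (fun d => d.2.2) := (snd _ _).snd'
  exact (((flatten natE).comp (map₀ h1)).pair (((flatten gpC).comp (map₀ h2)).pair ((flatten sedgeC).comp (map₀ h3)))).congr
    fun l => (concatD_eq l).symm

/-- Adding edges to drawing data. [cite: AroraBarak2009, §1.3] -/
theorem codeFP_addEdgesD : CodeFP (pairE sddC (rawE sedgeC)) sddC (fun q => addEdgesD q.1 q.2) := by
  have h1 : CodeFP (pairE sddC (rawE sedgeC)) (rawE natE) (fun q => q.1.1) := (fst _ _).fst'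
  have h2 : CodeFP (pairE sddC (rawE sedgeC)) (rawE gpC) (fun q => q.1.2.1) := (fst _ _).snd'.fst'
  have h3 : CodeFP (pairE sddC (rawE sedgeC)) (rawE sedgeC) (fun q => q.1.2.2) := (fst _ _).snd'.snd'
  have h4 : CodeFP (pairE sddC (rawE sedgeC)) (rawE sedgeC) (fun q => q.2) := snd _ _
  exact (h1.pair (h2.pair ((rawAppend sedgeC).comp (h3.pair h4)))).congr fun _ => rfl

variable {β : Type} {eβ : β → List Bool}

/-- **The data of a block drawing is typed polynomial time in the block list** (templates as data,
offsets, vectors). [cite: LiskiewiczOgiharaToda2003, §4 (proof of Theorem 7: the embedding is polynomial time)] -/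
theorem codeFP_blocksD {L : β → List (SDData × ℕ × GridPoint)} (hL : CodeFP eβ (rawE (pairE sddC (pairE natE gpC))) L) :
    CodeFP eβ sddC (fun b => concatD ((L b).map fun t => copyD t.1 t.2.1 t.2.2)) :=
  (codeFP_concatD.comp ((map₀ codeFP_copyD).comp hL)).congr fun _ => rfl

/-- Copying computed data by a computed offset and vector. [cite: AroraBarak2009, §1.3] -/
theorem codeFP_copyD' {d : β → SDData} {k : β → ℕ} {v : β → GridPoint} (hd : CodeFP eβ sddC d) (hk : CodeFP eβ natE k)
    (hv : CodeFP eβ gpC v) : CodeFP eβ sddC (fun b => copyD (d b) (k b) (v b)) :=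
  (codeFP_copyD.comp (hd.pair (hk.pair hv))).congr fun _ => rfl

/-- Juxtaposing computed data. [cite: AroraBarak2009, §1.3] -/
theorem codeFP_appendD' {d₁ d₂ : β → SDData} (h₁ : CodeFP eβ sddC d₁) (h₂ : CodeFP eβ sddC d₂) :
    CodeFP eβ sddC (fun b => appendD (d₁ b) (d₂ b)) :=
  (codeFP_appendD.comp (h₁.pair h₂)).congr fun _ => rfl

/-- Adding computed edges to computed data. [cite: AroraBarak2009, §1.3] -/
theorem codeFP_addEdgesD' {d : β → SDData} {E : β → List (SEdge ℕ)} (hd : CodeFP eβ sddC d) (hE : CodeFP eβ (rawE sedgeC) E) :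
    CodeFP eβ sddC (fun b => addEdgesD (d b) (E b)) :=
  (codeFP_addEdgesD.comp (hd.pair hE)).congr fun _ => rfl

/-- **Packaging for `LOT2003_lemma4_gadgets_of_family`**: from the data of the drawings and the two
end vertices, the `NamedDrawingData` in the code `ndC`. [cite: AroraBarak2009, §1.3] -/
theorem codeFP_familyData {S : β → SDrawing ℕ} {s t : β → ℕ} (hS : CodeFP eβ sddC fun b => (S b).data)
    (hs : CodeFP eβ natE s) (ht : CodeFP eβ natE t) :
    CodeFP eβ ndC fun b => ((S b).verts, (S b).verts.map (S b).pos, (S b).edges, s b, t b) :=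
  (hS.fst'.pair (hS.snd'.fst'.pair (hS.snd'.snd'.pair (hs.pair ht)))).congr fun _ => rfl

end FP

/-! ### The graph of a drawing -/

section Graph

variable {α : Type*} [DecidableEq α]

/-- **The graph drawn by a named drawing**: two names are adjacent iff some drawn edge joins them.
[cite: LiskiewiczOgiharaToda2003, §4 (proof of Theorem 7, E₀)] -/
def graph (S : SDrawing α) : _root_.SimpleGraph α :=
  _root_.SimpleGraph.fromRel fun a b => ∃ d ∈ S.edges, d.1 = a ∧ d.2.1 = b

omit [DecidableEq α] in
/-- Adjacency in the drawn graph. [folklore] -/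
theorem graph_adj_iff (S : SDrawing α) {a b : α} :
    S.graph.Adj a b ↔ a ≠ b ∧ ∃ d ∈ S.edges, (d.1 = a ∧ d.2.1 = b) ∨ (d.1 = b ∧ d.2.1 = a) := by
  rw [graph, _root_.SimpleGraph.fromRel_adj]
  refine and_congr_right fun _ => ⟨?_, ?_⟩
  · rintro (⟨d, hd, h⟩ | ⟨d, hd, h⟩)
    exacts [⟨d, hd, Or.inl h⟩, ⟨d, hd, Or.inr h⟩]
  · rintro ⟨d, hd, h | h⟩
    exacts [Or.inl ⟨d, hd, h⟩, Or.inr ⟨d, hd, h⟩]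

/-- Adjacency in the drawn graph is decidable. [folklore] -/
instance instDecidableRelGraphAdj (S : SDrawing α) : DecidableRel S.graph.Adj := fun _ _ =>
  decidable_of_iff _ S.graph_adj_iff.symm

/-- **For a valid drawing, the adjacency of its graph is "some drawn edge joins the two names"**
(the hypothesis `hadj` of `LOT2003_lemma4_gadgets_of_family`; loops are excluded by validity).
[folklore] -/
theorem IsValid.graph_adj_iff {S : SDrawing α} (hS : S.IsValid) {a b : α} :
    S.graph.Adj a b ↔ ∃ d ∈ S.edges, (d.1 = a ∧ d.2.1 = b) ∨ (d.1 = b ∧ d.2.1 = a) := by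
  rw [SDrawing.graph_adj_iff S]
  refine ⟨fun h => h.2, fun ⟨d, hd, h⟩ => ⟨?_, d, hd, h⟩⟩
  rcases h with ⟨rfl, rfl⟩ | ⟨rfl, rfl⟩
  exacts [hS.fst_ne_snd d hd, (hS.fst_ne_snd d hd).symm]

/-- Graphs with the same adjacency inside `V` have the same number of Hamiltonian `s`–`t` paths
through `V`. [folklore] -/
theorem hamCount_congr_adj {G G' : _root_.SimpleGraph α} {V : Finset α} (h : ∀ a ∈ V, ∀ b ∈ V, G.Adj a b ↔ G'.Adj a b)
    (s t : α) : Literature.Combinatorics.SimpleGraph.hamCount G V s t = Literature.Combinatorics.SimpleGraph.hamCount G' V s t := by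
  unfold Literature.Combinatorics.SimpleGraph.hamCount Literature.Combinatorics.SimpleGraph.hamCountRF
  congr 1
  ext l
  rw [Literature.Combinatorics.SimpleGraph.mem_hamSetRF_empty, Literature.Combinatorics.SimpleGraph.mem_hamSetRF_empty]
  exact ⟨fun hl => hl.mono fun a ha b hb hab => (h a ha b hb).1 hab, fun hl => hl.mono fun a ha b hb hab => (h a ha b hb).2 hab⟩

end Graph

end SDrawing

/-! ### Lemma 4 from a family of valid drawings -/

/-- **`LOT2003_lemma4_gadgets` from a family of valid named drawings**: if for every `ψ` in the
normal form of Lemma 3 the drawing `S ψ` is valid, its ends `s ψ, t ψ` are listed, and ITS OWN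
GRAPH has exactly `2^{e ψ} · #SAT(ψ)` Hamiltonian `s ψ`–`t ψ` paths (`0 < e ψ`), and the data of
`S ψ`, the ends and the exponent are typed polynomial time in the code of `ψ`, then
`SHARP3SATNF ≤ᵖ_{r-shift} GRIDHAMPATHCOUNT` — `LOT2003_lemma4_gadgets_of_family` with
`G ψ := (S ψ).graph` (`IsValid.graph_adj_iff`) and `codeFP_familyData`; a count proved for another
graph with the same adjacency on the listed names transfers by `hamCount_congr_adj`.
[cite: LiskiewiczOgiharaToda2003, Lemma 4 (proof) and §4 (proof of Theorem 7, E₀)] -/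
theorem LOT2003_lemma4_gadgets_of_drawings (S : CNF ℕ → SDrawing ℕ) (s t e : CNF ℕ → ℕ)
    (hvalid : ∀ ψ : CNF ℕ, ψ.IsLOTNormalForm → (S ψ).IsValid)
    (hs : ∀ ψ : CNF ℕ, ψ.IsLOTNormalForm → s ψ ∈ (S ψ).verts)
    (ht : ∀ ψ : CNF ℕ, ψ.IsLOTNormalForm → t ψ ∈ (S ψ).verts)
    (he : ∀ ψ : CNF ℕ, ψ.IsLOTNormalForm → 0 < e ψ)
    (hcount : ∀ ψ : CNF ℕ, ψ.IsLOTNormalForm →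
      Literature.Combinatorics.SimpleGraph.hamCount (S ψ).graph (S ψ).verts.toFinset (s ψ) (t ψ) = 2 ^ e ψ * ψ.numSat)
    (hSFP : CodeFP cnfC SDrawing.sddC fun ψ => (S ψ).data) (hsFP : CodeFP cnfC natE s) (htFP : CodeFP cnfC natE t)
    (heFP : CodeFP cnfC natE e) : LOT2003_lemma4_gadgets :=
  LOT2003_lemma4_gadgets_of_family S (fun ψ => (S ψ).graph) s t e hvalid
    (fun ψ hψ _ _ _ _ => (hvalid ψ hψ).graph_adj_iff) hs ht he hcount (SDrawing.codeFP_familyData hSFP hsFP htFP) heFP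

end Literature.Barriers.CriticalPhenomena.GridSAW
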